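import Mathlib
import Summits.NavierStokesRegularity.NavierStokesRegularity.Theorems.FilamentSkeletonRssClause13TransportAveraging

/-!
# Clause 13-J, brick B7-avg (variable coefficients): the J-averaging normal form with `α, β` VARYING along the ball

Route `FilamentSkeletonRss`, child 28296 `Clause13NearStraight` (and its A1L twin); design of record
`filament-plan/DESIGN-NOTE-28296-tenure-g22.md` §3 (I1)/(I2) and §6 (a) ("w′, B vary on the scale ρ√Γ").  The frozen-coefficient
normal form of `…Clause13TransportAveraging` is extended to coefficients `α(τ), β(τ)` (the local gradient along the filament; the rotation
rate `G` stays constant, as it is under the rigid-core typing A1L): with `κ(τ) = −iβ(τ)/(2G)` the variable `v = u + κ e^{−2iθ} ū` now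
satisfies `w·v′ = (α + κβ̄)v + R + (w κ′)·e^{−2iθ} ū` (`normalForm_identity_var`), the new term being of relative size `w|β′|/(2G)` —
under the class `≲ ΛR·(γ_k/ρ³Γ^{3/2})/(Γγ_j/πμ²) → 0`.  The sup bounds follow as before with this term added to the averaging error
(`farBranch_norm_le_of_amplified_var`, `farBranch_norm_le_of_damped_var`).  Typing-agnostic, natively `L∞`.
Lane ns-filament-19175-p1 g13; `--supports stmt-NavierStokesRegularity-28296 --as helper`.
HONEST FRAMING: ODE lemmas for the bookkeeping of a HYPOTHETICAL filament skeleton on the NEGATIVE side of a MODEL route; nothing here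
bears on Navier–Stokes regularity or blow-up.
-/

noncomputable section

open scoped InnerProductSpace ComplexConjugate
open Set Complex

namespace Summit.NavierStokesRegularity.NavierStokesRegularity.Theorems.Clause13Transport
set_option linter.dupNamespace false

/-- Derivative of the normal-form variable with a VARIABLE coefficient `κ(s)`: `v = u + κ·e^{−2iθ}·ū` has
`v′ = u′ + κ′ e^{−2iθ} ū + κ (e^{−2iθ})′ ū + κ e^{−2iθ} ū′`. [folklore] -/
theorem hasDerivAt_normalForm_var {u κ : ℝ → ℂ} {u' κ' : ℂ} {θ : ℝ → ℝ} {θ' τ : ℝ}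
    (hu : HasDerivAt u u' τ) (hκ : HasDerivAt κ κ' τ) (hθ : HasDerivAt θ θ' τ) :
    HasDerivAt (fun s => u s + κ s * cexp (-2 * I * (θ s : ℂ)) * conj (u s))
      (u' + κ' * cexp (-2 * I * (θ τ : ℂ)) * conj (u τ)
          + κ τ * (cexp (-2 * I * (θ τ : ℂ)) * (-2 * I * (θ' : ℂ))) * conj (u τ)
          + κ τ * cexp (-2 * I * (θ τ : ℂ)) * conj u') τ := by
  have hcu : HasDerivAt (fun s => conj (u s)) (conj u') τ := hu.star
  have hE := hasDerivAt_phase hθ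
  have h := hu.add ((hκ.mul hE).mul hcu)
  have hfun : (fun s => u s + κ s * cexp (-2 * I * (θ s : ℂ)) * conj (u s))
      = (u + (κ * fun y => cexp (-2 * I * (θ y : ℂ))) * fun s => conj (u s)) := by
    funext s; simp only [Pi.add_apply, Pi.mul_apply]
  rw [hfun]
  exact h.congr_deriv (by simp only [Pi.mul_apply]; ring)

/-- **The averaging identity with variable `β`.**  As `normalForm_identity`, with the extra derivative term of `κ`: the right-hand
side gains `(w κ′)·e^{−2iθ}·ū` verbatim. [folklore] -/
theorem normalForm_identity_var {w θ' G : ℝ} {U u' E g α β κ κ' : ℂ}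
    (hθ : (w : ℂ) * θ' = G) (hκ : 2 * (G : ℂ) * κ = -I * β) (hE : E * conj E = 1)
    (heq : (w : ℂ) * u' = α * U + β * E * conj U + g) :
    (w : ℂ) * (u' + κ' * E * conj U + κ * (E * (-2 * I * (θ' : ℂ))) * conj U + κ * E * conj u')
      = (α + κ * conj β) * (U + κ * E * conj U)
        + ((κ * E * conj U * (conj α - α - κ * conj β) + (g + κ * E * conj g))
          + ((w : ℂ) * κ') * E * conj U) := by
  have h := normalForm_identity hθ hκ hE heq
  linear_combination h

/-- `‖−iβ/(2G)‖ ≤ k` whenever `‖β‖ ≤ 2Gk`-type bookkeeping: `‖−iβ/(2G)‖ = ‖β‖/(2G)`. [folklore] -/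
theorem norm_kappa_le {G βmax : ℝ} (hG : 0 < G) {β : ℂ} (hβ : ‖β‖ ≤ βmax) :
    ‖-I * β / (2 * (G : ℂ))‖ ≤ βmax / (2 * G) := by
  rw [norm_kappa hG]
  exact div_le_div_of_nonneg_right hβ (by positivity)

/-- **B7-avg with variable coefficients, outer region.**  `w·u′ = α(τ)u + β(τ)e^{−2iθ}ū + g` on `[a, b]`, `w θ′ = G > 0`, `w > 0`,
`‖g‖ ≤ M`, `‖β‖ ≤ βmax ≤ G`, `β` differentiable; J-averaged growth beyond the averaging AND variation errors:
`β₀ ≤ Re α(τ) − (k/(1−k))(2|Im α(τ)| + k‖β τ‖) − (w τ‖β′ τ‖/(2G))/(1−k)`, `k = βmax/(2G)`.  If `u b = 0` then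
`‖u τ‖ ≤ ((1+k)M/β₀)/(1−k)` on `[a, b]`. [folklore] -/
theorem farBranch_norm_le_of_amplified_var {u u' g α β β' : ℝ → ℂ} {θ θ' w : ℝ → ℝ} {a b G M β₀ βmax : ℝ}
    (hG : 0 < G) (hM : 0 ≤ M) (hβ₀ : 0 < β₀) (hβmax0 : 0 ≤ βmax)
    (hu : ∀ τ ∈ Icc a b, HasDerivAt u (u' τ) τ) (hθ : ∀ τ ∈ Icc a b, HasDerivAt θ (θ' τ) τ)
    (hβ : ∀ τ ∈ Icc a b, HasDerivAt β (β' τ) τ)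
    (hw : ∀ τ ∈ Icc a b, 0 < w τ) (hwθ : ∀ τ ∈ Icc a b, w τ * θ' τ = G)
    (hode : ∀ τ ∈ Icc a b, (w τ : ℂ) * u' τ = α τ * u τ + β τ * cexp (-2 * I * (θ τ : ℂ)) * conj (u τ) + g τ)
    (hg : ∀ τ ∈ Icc a b, ‖g τ‖ ≤ M) (hβmax : ∀ τ ∈ Icc a b, ‖β τ‖ ≤ βmax) (hsmall : βmax ≤ G)
    (hgain : ∀ τ ∈ Icc a b, β₀ ≤ (α τ).re
      - (βmax / (2 * G)) / (1 - βmax / (2 * G)) * (2 * |(α τ).im| + βmax / (2 * G) * ‖β τ‖)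
      - (w τ * ‖β' τ‖ / (2 * G)) / (1 - βmax / (2 * G)))
    (hb : u b = 0) :
    ∀ τ ∈ Icc a b, ‖u τ‖ ≤ ((1 + βmax / (2 * G)) * M / β₀) / (1 - βmax / (2 * G)) := by
  set κ : ℝ → ℂ := fun s => -I * β s / (2 * (G : ℂ)) with hκdef
  set κ' : ℝ → ℂ := fun s => -I * β' s / (2 * (G : ℂ)) with hκ'def
  set k : ℝ := βmax / (2 * G) with hkdef
  have hk0 : 0 ≤ k := by positivity
  have hk1 : k ≤ 1 / 2 := by rw [hkdef, div_le_iff₀ (by positivity)]; linarith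
  have hk1' : 0 < 1 - k := by linarith
  have hG' : (G : ℂ) ≠ 0 := by exact_mod_cast hG.ne'
  have hκeq : ∀ s, 2 * (G : ℂ) * κ s = -I * β s := fun s => by simp only [hκdef]; field_simp
  have hκnorm : ∀ τ ∈ Icc a b, ‖κ τ‖ ≤ k := fun τ hτ => norm_kappa_le hG (hβmax τ hτ)
  have hκ'norm : ∀ s, ‖κ' s‖ = ‖β' s‖ / (2 * G) := fun s => norm_kappa hG (β' s)
  have hκder : ∀ τ ∈ Icc a b, HasDerivAt κ (κ' τ) τ := fun τ hτ => by
    have := ((hβ τ hτ).const_mul (-I)).div_const (2 * (G : ℂ))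
    simpa [hκdef, hκ'def] using this
  set E : ℝ → ℂ := fun s => cexp (-2 * I * (θ s : ℂ)) with hEdef
  set v : ℝ → ℂ := fun s => u s + κ s * E s * conj (u s) with hvdef
  set v' : ℝ → ℂ := fun s => u' s + κ' s * E s * conj (u s) + κ s * (E s * (-2 * I * (θ' s : ℂ))) * conj (u s)
    + κ s * E s * conj (u' s) with hv'def
  have hEnorm : ∀ s, ‖E s‖ = 1 := fun s => norm_phase (θ s)
  have hEE : ∀ s, E s * conj (E s) = 1 := fun s => phase_mul_conj_phase (θ s)
  have hvder : ∀ τ ∈ Icc a b, HasDerivAt v (v' τ) τ := fun τ hτ =>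
    hasDerivAt_normalForm_var (hu τ hτ) (hκder τ hτ) (hθ τ hτ)
  have hκE : ∀ τ ∈ Icc a b, ∀ z : ℂ, ‖κ τ * E τ * conj z‖ ≤ k * ‖z‖ := fun τ hτ z => by
    rw [norm_mul, norm_mul, hEnorm, mul_one, Complex.norm_conj]
    exact mul_le_mul_of_nonneg_right (hκnorm τ hτ) (norm_nonneg _)
  -- `‖u‖ ≤ ‖v‖/(1−k)` on the interval
  have huv : ∀ τ ∈ Icc a b, ‖u τ‖ ≤ ‖v τ‖ / (1 - k) := by
    intro s hs
    rw [le_div_iff₀ hk1']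
    have h1 : ‖u s‖ ≤ ‖v s‖ + ‖κ s * E s * conj (u s)‖ := by
      have : u s = v s - κ s * E s * conj (u s) := by simp [hvdef]
      calc ‖u s‖ = ‖v s - κ s * E s * conj (u s)‖ := by rw [← this]
        _ ≤ ‖v s‖ + ‖κ s * E s * conj (u s)‖ := norm_sub_le _ _
    have h2 := hκE s hs (u s)
    nlinarith
  -- radial inequality
  have hrad : ∀ τ ∈ Ioc a b, (w τ)⁻¹ * (‖v τ‖ * (β₀ * ‖v τ‖ - (1 + k) * M)) ≤ ⟪v' τ, v τ⟫_ℝ := by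
    intro τ hτ
    have hτ' : τ ∈ Icc a b := Ioc_subset_Icc_self hτ
    have hwτ := hw τ hτ'
    have hid := normalForm_identity_var (U := u τ) (u' := u' τ) (g := g τ) (α := α τ) (β := β τ) (κ' := κ' τ)
      (by exact_mod_cast hwθ τ hτ') (hκeq τ) (hEE τ) (hode τ hτ')
    have hR := radial_identity (w := w τ) (v := v τ) (v' := v' τ) hid
    have hre : (α τ + κ τ * conj (β τ)).re = (α τ).re := by
      rw [Complex.add_re, re_kappa_mul_conj hG.ne' (hκeq τ), add_zero]
    rw [hre] at hR
    set R₁ : ℂ := κ τ * E τ * conj (u τ) * (conj (α τ) - α τ - κ τ * conj (β τ)) with hR₁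
    set R₂ : ℂ := g τ + κ τ * E τ * conj (g τ) with hR₂
    set R₃ : ℂ := ((w τ : ℂ) * κ' τ) * E τ * conj (u τ) with hR₃
    have hR₁le : ‖R₁‖ ≤ k * ‖u τ‖ * (2 * |(α τ).im| + k * ‖β τ‖) := by
      rw [hR₁, norm_mul]
      have h1 := hκE τ hτ' (u τ)
      have h2 : ‖conj (α τ) - α τ - κ τ * conj (β τ)‖ ≤ 2 * |(α τ).im| + k * ‖β τ‖ := by
        calc ‖conj (α τ) - α τ - κ τ * conj (β τ)‖ ≤ ‖conj (α τ) - α τ‖ + ‖κ τ * conj (β τ)‖ := norm_sub_le _ _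
          _ ≤ 2 * |(α τ).im| + k * ‖β τ‖ := by
              rw [norm_conj_sub_self, norm_mul, Complex.norm_conj]
              gcongr
              exact hκnorm τ hτ'
      have h3 : 0 ≤ 2 * |(α τ).im| + k * ‖β τ‖ := by positivity
      calc ‖κ τ * E τ * conj (u τ)‖ * ‖conj (α τ) - α τ - κ τ * conj (β τ)‖
          ≤ (k * ‖u τ‖) * (2 * |(α τ).im| + k * ‖β τ‖) := by gcongr
        _ = k * ‖u τ‖ * (2 * |(α τ).im| + k * ‖β τ‖) := by ring
    have hR₂le : ‖R₂‖ ≤ (1 + k) * M := by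
      rw [hR₂]
      calc ‖g τ + κ τ * E τ * conj (g τ)‖ ≤ ‖g τ‖ + ‖κ τ * E τ * conj (g τ)‖ := norm_add_le _ _
        _ ≤ ‖g τ‖ + k * ‖g τ‖ := by gcongr; exact hκE τ hτ' (g τ)
        _ = (1 + k) * ‖g τ‖ := by ring
        _ ≤ (1 + k) * M := by gcongr; exact hg τ hτ'
    have hR₃le : ‖R₃‖ ≤ (w τ * ‖β' τ‖ / (2 * G)) * ‖u τ‖ := by
      rw [hR₃, norm_mul, norm_mul, norm_mul, hEnorm, mul_one, Complex.norm_conj, Complex.norm_real, Real.norm_eq_abs,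
        abs_of_pos hwτ, hκ'norm]
      ring_nf
      rfl
    have hinner : -((‖R₁‖ + ‖R₂‖ + ‖R₃‖) * ‖v τ‖) ≤ ⟪R₁ + R₂ + R₃, v τ⟫_ℝ := by
      have h1 := abs_real_inner_le_norm (R₁ + R₂ + R₃) (v τ)
      have h2 : ‖R₁ + R₂ + R₃‖ ≤ ‖R₁‖ + ‖R₂‖ + ‖R₃‖ := norm_add₃_le
      have h3 : |⟪R₁ + R₂ + R₃, v τ⟫_ℝ| ≤ (‖R₁‖ + ‖R₂‖ + ‖R₃‖) * ‖v τ‖ := h1.trans (by gcongr)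
      linarith [abs_le.1 h3]
    have hu' := huv τ hτ'
    have hv0 := norm_nonneg (v τ)
    have hη : ‖R₁‖ * ‖v τ‖ ≤ (k / (1 - k) * (2 * |(α τ).im| + k * ‖β τ‖)) * ‖v τ‖ ^ 2 := by
      have : ‖R₁‖ ≤ (k / (1 - k) * (2 * |(α τ).im| + k * ‖β τ‖)) * ‖v τ‖ := by
        calc ‖R₁‖ ≤ k * ‖u τ‖ * (2 * |(α τ).im| + k * ‖β τ‖) := hR₁le
          _ ≤ k * (‖v τ‖ / (1 - k)) * (2 * |(α τ).im| + k * ‖β τ‖) := by gcongr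
          _ = (k / (1 - k) * (2 * |(α τ).im| + k * ‖β τ‖)) * ‖v τ‖ := by field_simp
      nlinarith
    have hη₃ : ‖R₃‖ * ‖v τ‖ ≤ ((w τ * ‖β' τ‖ / (2 * G)) / (1 - k)) * ‖v τ‖ ^ 2 := by
      have : ‖R₃‖ ≤ ((w τ * ‖β' τ‖ / (2 * G)) / (1 - k)) * ‖v τ‖ := by
        calc ‖R₃‖ ≤ (w τ * ‖β' τ‖ / (2 * G)) * ‖u τ‖ := hR₃le
          _ ≤ (w τ * ‖β' τ‖ / (2 * G)) * (‖v τ‖ / (1 - k)) := by gcongr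
          _ = ((w τ * ‖β' τ‖ / (2 * G)) / (1 - k)) * ‖v τ‖ := by field_simp
      nlinarith
    have hmain : ‖v τ‖ * (β₀ * ‖v τ‖ - (1 + k) * M) ≤ w τ * ⟪v' τ, v τ⟫_ℝ := by
      rw [hR]
      have hg2 : β₀ * ‖v τ‖ ^ 2 ≤ ((α τ).re - k / (1 - k) * (2 * |(α τ).im| + k * ‖β τ‖)
          - (w τ * ‖β' τ‖ / (2 * G)) / (1 - k)) * ‖v τ‖ ^ 2 :=
        mul_le_mul_of_nonneg_right (hgain τ hτ') (sq_nonneg _)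
      nlinarith
    rw [inv_mul_le_iff₀ hwτ]
    exact hmain
  have hvb : ‖v b‖ ≤ (1 + k) * M / β₀ := by
    have : v b = 0 := by simp [hvdef, hb]
    rw [this, norm_zero]; positivity
  have hMf : 0 ≤ (1 + k) * M := by positivity
  have hfence := norm_le_of_le_inner_deriv (ρ := fun τ => (w τ)⁻¹) hβ₀ hMf hvder
    (fun τ hτ => inv_pos.mpr (hw τ (Ioc_subset_Icc_self hτ))) hrad hvb
  intro τ hτ
  calc ‖u τ‖ ≤ ‖v τ‖ / (1 - k) := huv τ hτ
    _ ≤ ((1 + k) * M / β₀) / (1 - k) := by gcongr; exact hfence τ hτ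

/-- **B7-avg with variable coefficients, inner region (damped twin).**  Same system with J-averaged damping beyond the averaging and
variation errors, `β₀ ≤ −Re α(τ) − (k/(1−k))(2|Im α(τ)| + k‖β τ‖) − (w τ‖β′ τ‖/(2G))/(1−k)`; if `‖u a‖ ≤ M/β₀` then
`‖u τ‖ ≤ ((1+k)M/β₀)/(1−k)` on `[a, b]`. [folklore] -/
theorem farBranch_norm_le_of_damped_var {u u' g α β β' : ℝ → ℂ} {θ θ' w : ℝ → ℝ} {a b G M β₀ βmax : ℝ}
    (hG : 0 < G) (hM : 0 ≤ M) (hβ₀ : 0 < β₀) (hβmax0 : 0 ≤ βmax)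
    (hu : ∀ τ ∈ Icc a b, HasDerivAt u (u' τ) τ) (hθ : ∀ τ ∈ Icc a b, HasDerivAt θ (θ' τ) τ)
    (hβ : ∀ τ ∈ Icc a b, HasDerivAt β (β' τ) τ)
    (hw : ∀ τ ∈ Icc a b, 0 < w τ) (hwθ : ∀ τ ∈ Icc a b, w τ * θ' τ = G)
    (hode : ∀ τ ∈ Icc a b, (w τ : ℂ) * u' τ = α τ * u τ + β τ * cexp (-2 * I * (θ τ : ℂ)) * conj (u τ) + g τ)
    (hg : ∀ τ ∈ Icc a b, ‖g τ‖ ≤ M) (hβmax : ∀ τ ∈ Icc a b, ‖β τ‖ ≤ βmax) (hsmall : βmax ≤ G)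
    (hgain : ∀ τ ∈ Icc a b, β₀ ≤ -(α τ).re
      - (βmax / (2 * G)) / (1 - βmax / (2 * G)) * (2 * |(α τ).im| + βmax / (2 * G) * ‖β τ‖)
      - (w τ * ‖β' τ‖ / (2 * G)) / (1 - βmax / (2 * G)))
    (ha : ‖u a‖ ≤ M / β₀) :
    ∀ τ ∈ Icc a b, ‖u τ‖ ≤ ((1 + βmax / (2 * G)) * M / β₀) / (1 - βmax / (2 * G)) := by
  set κ : ℝ → ℂ := fun s => -I * β s / (2 * (G : ℂ)) with hκdef
  set κ' : ℝ → ℂ := fun s => -I * β' s / (2 * (G : ℂ)) with hκ'def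
  set k : ℝ := βmax / (2 * G) with hkdef
  have hk0 : 0 ≤ k := by positivity
  have hk1 : k ≤ 1 / 2 := by rw [hkdef, div_le_iff₀ (by positivity)]; linarith
  have hk1' : 0 < 1 - k := by linarith
  have hG' : (G : ℂ) ≠ 0 := by exact_mod_cast hG.ne'
  have hκeq : ∀ s, 2 * (G : ℂ) * κ s = -I * β s := fun s => by simp only [hκdef]; field_simp
  have hκnorm : ∀ τ ∈ Icc a b, ‖κ τ‖ ≤ k := fun τ hτ => norm_kappa_le hG (hβmax τ hτ)
  have hκ'norm : ∀ s, ‖κ' s‖ = ‖β' s‖ / (2 * G) := fun s => norm_kappa hG (β' s)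
  have hκder : ∀ τ ∈ Icc a b, HasDerivAt κ (κ' τ) τ := fun τ hτ => by
    have := ((hβ τ hτ).const_mul (-I)).div_const (2 * (G : ℂ))
    simpa [hκdef, hκ'def] using this
  set E : ℝ → ℂ := fun s => cexp (-2 * I * (θ s : ℂ)) with hEdef
  set v : ℝ → ℂ := fun s => u s + κ s * E s * conj (u s) with hvdef
  set v' : ℝ → ℂ := fun s => u' s + κ' s * E s * conj (u s) + κ s * (E s * (-2 * I * (θ' s : ℂ))) * conj (u s)
    + κ s * E s * conj (u' s) with hv'def
  have hEnorm : ∀ s, ‖E s‖ = 1 := fun s => norm_phase (θ s)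
  have hEE : ∀ s, E s * conj (E s) = 1 := fun s => phase_mul_conj_phase (θ s)
  have hvder : ∀ τ ∈ Icc a b, HasDerivAt v (v' τ) τ := fun τ hτ =>
    hasDerivAt_normalForm_var (hu τ hτ) (hκder τ hτ) (hθ τ hτ)
  have hκE : ∀ τ ∈ Icc a b, ∀ z : ℂ, ‖κ τ * E τ * conj z‖ ≤ k * ‖z‖ := fun τ hτ z => by
    rw [norm_mul, norm_mul, hEnorm, mul_one, Complex.norm_conj]
    exact mul_le_mul_of_nonneg_right (hκnorm τ hτ) (norm_nonneg _)
  have huv : ∀ τ ∈ Icc a b, ‖u τ‖ ≤ ‖v τ‖ / (1 - k) := by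
    intro s hs
    rw [le_div_iff₀ hk1']
    have h1 : ‖u s‖ ≤ ‖v s‖ + ‖κ s * E s * conj (u s)‖ := by
      have : u s = v s - κ s * E s * conj (u s) := by simp [hvdef]
      calc ‖u s‖ = ‖v s - κ s * E s * conj (u s)‖ := by rw [← this]
        _ ≤ ‖v s‖ + ‖κ s * E s * conj (u s)‖ := norm_sub_le _ _
    have h2 := hκE s hs (u s)
    nlinarith
  have hrad : ∀ τ ∈ Ico a b, ⟪v' τ, v τ⟫_ℝ ≤ (w τ)⁻¹ * (‖v τ‖ * ((1 + k) * M - β₀ * ‖v τ‖)) := by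
    intro τ hτ
    have hτ' : τ ∈ Icc a b := Ico_subset_Icc_self hτ
    have hwτ := hw τ hτ'
    have hid := normalForm_identity_var (U := u τ) (u' := u' τ) (g := g τ) (α := α τ) (β := β τ) (κ' := κ' τ)
      (by exact_mod_cast hwθ τ hτ') (hκeq τ) (hEE τ) (hode τ hτ')
    have hR := radial_identity (w := w τ) (v := v τ) (v' := v' τ) hid
    have hre : (α τ + κ τ * conj (β τ)).re = (α τ).re := by
      rw [Complex.add_re, re_kappa_mul_conj hG.ne' (hκeq τ), add_zero]
    rw [hre] at hR
    set R₁ : ℂ := κ τ * E τ * conj (u τ) * (conj (α τ) - α τ - κ τ * conj (β τ)) with hR₁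
    set R₂ : ℂ := g τ + κ τ * E τ * conj (g τ) with hR₂
    set R₃ : ℂ := ((w τ : ℂ) * κ' τ) * E τ * conj (u τ) with hR₃
    have hR₁le : ‖R₁‖ ≤ k * ‖u τ‖ * (2 * |(α τ).im| + k * ‖β τ‖) := by
      rw [hR₁, norm_mul]
      have h1 := hκE τ hτ' (u τ)
      have h2 : ‖conj (α τ) - α τ - κ τ * conj (β τ)‖ ≤ 2 * |(α τ).im| + k * ‖β τ‖ := by
        calc ‖conj (α τ) - α τ - κ τ * conj (β τ)‖ ≤ ‖conj (α τ) - α τ‖ + ‖κ τ * conj (β τ)‖ := norm_sub_le _ _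
          _ ≤ 2 * |(α τ).im| + k * ‖β τ‖ := by
              rw [norm_conj_sub_self, norm_mul, Complex.norm_conj]
              gcongr
              exact hκnorm τ hτ'
      have h3 : 0 ≤ 2 * |(α τ).im| + k * ‖β τ‖ := by positivity
      calc ‖κ τ * E τ * conj (u τ)‖ * ‖conj (α τ) - α τ - κ τ * conj (β τ)‖
          ≤ (k * ‖u τ‖) * (2 * |(α τ).im| + k * ‖β τ‖) := by gcongr
        _ = k * ‖u τ‖ * (2 * |(α τ).im| + k * ‖β τ‖) := by ring
    have hR₂le : ‖R₂‖ ≤ (1 + k) * M := by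
      rw [hR₂]
      calc ‖g τ + κ τ * E τ * conj (g τ)‖ ≤ ‖g τ‖ + ‖κ τ * E τ * conj (g τ)‖ := norm_add_le _ _
        _ ≤ ‖g τ‖ + k * ‖g τ‖ := by gcongr; exact hκE τ hτ' (g τ)
        _ = (1 + k) * ‖g τ‖ := by ring
        _ ≤ (1 + k) * M := by gcongr; exact hg τ hτ'
    have hR₃le : ‖R₃‖ ≤ (w τ * ‖β' τ‖ / (2 * G)) * ‖u τ‖ := by
      rw [hR₃, norm_mul, norm_mul, norm_mul, hEnorm, mul_one, Complex.norm_conj, Complex.norm_real, Real.norm_eq_abs,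
        abs_of_pos hwτ, hκ'norm]
      ring_nf
      rfl
    have hinner : ⟪R₁ + R₂ + R₃, v τ⟫_ℝ ≤ (‖R₁‖ + ‖R₂‖ + ‖R₃‖) * ‖v τ‖ := by
      have h1 := abs_real_inner_le_norm (R₁ + R₂ + R₃) (v τ)
      have h3 : |⟪R₁ + R₂ + R₃, v τ⟫_ℝ| ≤ (‖R₁‖ + ‖R₂‖ + ‖R₃‖) * ‖v τ‖ := h1.trans (by gcongr; exact norm_add₃_le)
      linarith [abs_le.1 h3]
    have hu' := huv τ hτ'
    have hv0 := norm_nonneg (v τ)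
    have hη : ‖R₁‖ * ‖v τ‖ ≤ (k / (1 - k) * (2 * |(α τ).im| + k * ‖β τ‖)) * ‖v τ‖ ^ 2 := by
      have : ‖R₁‖ ≤ (k / (1 - k) * (2 * |(α τ).im| + k * ‖β τ‖)) * ‖v τ‖ := by
        calc ‖R₁‖ ≤ k * ‖u τ‖ * (2 * |(α τ).im| + k * ‖β τ‖) := hR₁le
          _ ≤ k * (‖v τ‖ / (1 - k)) * (2 * |(α τ).im| + k * ‖β τ‖) := by gcongr
          _ = (k / (1 - k) * (2 * |(α τ).im| + k * ‖β τ‖)) * ‖v τ‖ := by field_simp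
      nlinarith
    have hη₃ : ‖R₃‖ * ‖v τ‖ ≤ ((w τ * ‖β' τ‖ / (2 * G)) / (1 - k)) * ‖v τ‖ ^ 2 := by
      have : ‖R₃‖ ≤ ((w τ * ‖β' τ‖ / (2 * G)) / (1 - k)) * ‖v τ‖ := by
        calc ‖R₃‖ ≤ (w τ * ‖β' τ‖ / (2 * G)) * ‖u τ‖ := hR₃le
          _ ≤ (w τ * ‖β' τ‖ / (2 * G)) * (‖v τ‖ / (1 - k)) := by gcongr
          _ = ((w τ * ‖β' τ‖ / (2 * G)) / (1 - k)) * ‖v τ‖ := by field_simp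
      nlinarith
    have hmain : w τ * ⟪v' τ, v τ⟫_ℝ ≤ ‖v τ‖ * ((1 + k) * M - β₀ * ‖v τ‖) := by
      rw [hR]
      have hg2 : β₀ * ‖v τ‖ ^ 2 ≤ (-(α τ).re - k / (1 - k) * (2 * |(α τ).im| + k * ‖β τ‖)
          - (w τ * ‖β' τ‖ / (2 * G)) / (1 - k)) * ‖v τ‖ ^ 2 :=
        mul_le_mul_of_nonneg_right (hgain τ hτ') (sq_nonneg _)
      nlinarith
    rw [le_inv_mul_iff₀ hwτ]
    exact hmain
  intro τ hτ
  have hab : a ≤ b := hτ.1.trans hτ.2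
  have haI : a ∈ Icc a b := ⟨le_rfl, hab⟩
  have hva : ‖v a‖ ≤ (1 + k) * M / β₀ := by
    calc ‖v a‖ ≤ ‖u a‖ + ‖κ a * E a * conj (u a)‖ := norm_add_le _ _
      _ ≤ ‖u a‖ + k * ‖u a‖ := by gcongr; exact hκE a haI (u a)
      _ = (1 + k) * ‖u a‖ := by ring
      _ ≤ (1 + k) * (M / β₀) := by gcongr
      _ = (1 + k) * M / β₀ := by ring
  have hMf : 0 ≤ (1 + k) * M := by positivity
  have hfence := norm_le_of_inner_deriv_le (ρ := fun τ => (w τ)⁻¹) hβ₀ hMf hvder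
    (fun τ hτ => inv_pos.mpr (hw τ (Ico_subset_Icc_self hτ))) hrad hva
  calc ‖u τ‖ ≤ ‖v τ‖ / (1 - k) := huv τ hτ
    _ ≤ ((1 + k) * M / β₀) / (1 - k) := by gcongr; exact hfence τ hτ

end Summit.NavierStokesRegularity.NavierStokesRegularity.Theorems.Clause13Transport
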